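import Literature.Analysis.FluidPDE.NSHopfLimit
import Literature.Analysis.FunctionSpaces.TorusSobolevNormProofs
import Literature.Analysis.FunctionSpaces.TorusWeightedGalerkinCoefficients
import Literature.Analysis.FunctionSpaces.TorusHNegOnePairing
import Literature.Analysis.FunctionSpaces.TorusSobolevSpaceProofs
import Literature.Analysis.FunctionSpaces.TorusTimeAverage
import HarnessLib

/-!
# Fourier projection of real `L²` vector fields onto symmetric frequency sets (Bloch sectors)

Analysis/FluidPDE support file. For a real vector field `w ∈ L²(T^d; ℝ^d)` and a frequency set
`S ⊆ ℤ^d` which is symmetric (`k ∈ S → -k ∈ S`), the field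
`P_S w = Torus.fourierSetProj S w : T^d → ℝ^d` with Fourier coefficients `𝟙_S(k) ŵ(k)`
(Riesz–Fischer `Torus.exists_memLp_two_forall_mFourierCoeff_eq_of_summable` applied to the truncated
coefficient family, then the real part — which loses nothing because the truncated family of a real
field stays conjugate-symmetric when `S = -S`, `Torus.mFourierCoeff_complexify_realPart_comp_of_isConjSymm`;
Grafakos 2014, Prop. 3.2.7 (4) with Prop. 3.2.6 (4)). Proved here:

* `memLp_two_fourierSetProj`, `mFourierCoeff_fourierSetProj` (`= S.indicator ŵ`);
* the projection preserves weak incompressibility (`isWeaklyDivFree_fourierSetProj`, via the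
  Fourier-side criterion `isWeaklyDivFree_of_sum_mul_mFourierCoeff_eq_zero`), zero mean
  (`hasZeroMean_fourierSetProj`), and every Sobolev class `H^s` (`memSobolev_fourierSetProj`:
  `‖P_S w‖_{H^s} ≤ ‖w‖_{H^s}`);
* Parseval `∫ ‖P_S w‖² = ∑' ‖𝟙_S ŵ‖²` (`integral_norm_sq_fourierSetProj`);
* additivity: `P_{S₁ ∪ S₂} w = P_{S₁} w + P_{S₂} w` a.e. for disjoint symmetric sets, `P_{ℤ^d} w = w`
  a.e., `P_S w + P_{Sᶜ} w = w` a.e., finite disjoint families;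
* Bloch sectors `blochSector n ℓ = (ℓ + nℤ^d) ∪ (-ℓ + nℤ^d)`: symmetric (`neg_mem_blochSector`), residue
  description, and a finite pairwise-disjoint covering of `ℤ^d` by them (`exists_finset_blochSector_partition`);
* `exists_blochSector_pieces` — the Bloch-sector splitting of an `L²` datum `w = ∑_ℓ v ℓ` (pointwise),
  pieces Fourier-supported in pairwise disjoint sectors, inheriting `H^s` / weak incompressibility /
  zero mean.

This is the splitting of an `H¹` divergence-free mean-zero datum into Bloch-sector pieces used by
the Floquet–Bloch line of crux K2R `RealisedQuasiStaticCellLaw` (route `SolenoidalFractalHomogenisation`,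
stub `stub_sectorPieces`): the Bloch sectors `{k ≡ ±ℓ mod n}` are symmetric sets.

## Mathlib / tree search

Tree: `TorusSobolevNormProofs` (Riesz–Fischer, `ae_eq_of_forall_mFourierCoeff_eq`), `TorusSpaceTimeFields`
(`mFourierCoeff_complexify_realPart_comp_of_isConjSymm`), `TorusTrigPoly` (`IsConjSymm`,
`isConjSymm_mFourierCoeff`, `EuclideanSpace.realPart`), `TorusTimePeriodicLift.conjVec_mFourierCoeff_complexify`,
`TorusVectorParseval`, `NSHopfLimit.isWeaklyDivFree_of_sum_mul_mFourierCoeff_eq_zero`,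
`TorusWeightedGalerkinCoefficients.hasZeroMean_of_mFourierCoeff_zero`, `TorusSobolevNorm` (`MemSobolev`,
`eSobolevNorm`). Mathlib: no Fourier multipliers on `T^d`.

## References

* L. Grafakos, *Classical Fourier Analysis*, 3rd ed., GTM 249 (2014), Prop. 3.2.7 (4) (Riesz–Fischer /
  Plancherel on `T^d`), Prop. 3.2.6 (4) (conjugation). [`Grafakos2014`]
-/

noncomputable section

open MeasureTheory Set Filter Function TopologicalSpace Complex UnitAddTorus
open scoped ENNReal NNReal InnerProductSpace ComplexConjugate

namespace Literature.Analysis.FluidPDE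

namespace Torus

variable {d : Type*} [Fintype d]

/-! ## The truncated coefficient family -/

/-- The coefficient family of the projection: `𝟙_S(k) ŵ(k)`. [cite: Grafakos2014, Prop. 3.2.7 (4)] -/
def sectorCoeff (S : Set (d → ℤ)) (w : UnitAddTorus d → EuclideanSpace ℝ d) (k : d → ℤ) : EuclideanSpace ℂ d :=
  S.indicator (fun k => mFourierCoeff (FunctionSpaces.EuclideanSpace.complexify ∘ w) k) k

/-- `sectorCoeff S w k = ŵ(k)` for `k ∈ S`. [cite: Grafakos2014, Prop. 3.2.7 (4)] -/
theorem sectorCoeff_of_mem {S : Set (d → ℤ)} {w : UnitAddTorus d → EuclideanSpace ℝ d} {k : d → ℤ} (hk : k ∈ S) :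
    sectorCoeff S w k = mFourierCoeff (FunctionSpaces.EuclideanSpace.complexify ∘ w) k :=
  indicator_of_mem hk _

/-- `sectorCoeff S w k = 0` for `k ∉ S`. [cite: Grafakos2014, Prop. 3.2.7 (4)] -/
theorem sectorCoeff_of_not_mem {S : Set (d → ℤ)} {w : UnitAddTorus d → EuclideanSpace ℝ d} {k : d → ℤ}
    (hk : k ∉ S) : sectorCoeff S w k = 0 :=
  indicator_of_notMem hk _

/-- `‖sectorCoeff S w k‖ ≤ ‖ŵ(k)‖`. [cite: Grafakos2014, Prop. 3.2.7 (4)] -/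
theorem norm_sectorCoeff_le (S : Set (d → ℤ)) (w : UnitAddTorus d → EuclideanSpace ℝ d) (k : d → ℤ) :
    ‖sectorCoeff S w k‖ ≤ ‖mFourierCoeff (FunctionSpaces.EuclideanSpace.complexify ∘ w) k‖ := by
  by_cases hk : k ∈ S
  · rw [sectorCoeff_of_mem hk]
  · rw [sectorCoeff_of_not_mem hk, norm_zero]
    exact norm_nonneg _

/-- The truncated coefficients of an `L²` field are square summable. [cite: Grafakos2014, Prop. 3.2.7 (3)] -/
theorem summable_sq_norm_sectorCoeff (S : Set (d → ℤ)) {w : UnitAddTorus d → EuclideanSpace ℝ d}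
    (hw : MemLp w 2 volume) : Summable fun k => ‖sectorCoeff S w k‖ ^ 2 :=
  (FunctionSpaces.Torus.hasSum_sq_norm_mFourierCoeff_complexify hw).summable.of_nonneg_of_le
    (fun _ => sq_nonneg _) fun k => pow_le_pow_left₀ (norm_nonneg _) (norm_sectorCoeff_le S w k) 2

/-- For a SYMMETRIC frequency set the truncated coefficient family of a real field is conjugate
symmetric. [cite: Grafakos2014, Prop. 3.2.6 (4)] -/
theorem isConjSymm_sectorCoeff {S : Set (d → ℤ)} (hS : ∀ k ∈ S, -k ∈ S)
    {w : UnitAddTorus d → EuclideanSpace ℝ d} (hw : Integrable w volume) :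
    FunctionSpaces.Torus.IsConjSymm (sectorCoeff S w) := by
  intro k
  by_cases hk : k ∈ S
  · rw [sectorCoeff_of_mem hk, sectorCoeff_of_mem (hS k hk)]
    exact (FunctionSpaces.Torus.isConjSymm_mFourierCoeff hw) k
  · have hk' : -k ∉ S := fun h => hk (by simpa using hS (-k) h)
    rw [sectorCoeff_of_not_mem hk, sectorCoeff_of_not_mem hk', FunctionSpaces.EuclideanSpace.conjVec_zero]

/-! ## The projected field -/

open Classical in
/-- **The Fourier projection of a real `L²` field onto a frequency set**: the real field with
coefficients `𝟙_S ŵ` (Riesz–Fischer, then real part); junk value `0` if the truncated family is not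
square summable (never the case for `w ∈ L²`). [cite: Grafakos2014, Prop. 3.2.7 (4)] -/
def fourierSetProj (S : Set (d → ℤ)) (w : UnitAddTorus d → EuclideanSpace ℝ d) :
    UnitAddTorus d → EuclideanSpace ℝ d :=
  if h : Summable fun k => ‖sectorCoeff S w k‖ ^ 2 then
    fun x => FunctionSpaces.EuclideanSpace.realPart
      (Classical.choose (FunctionSpaces.Torus.exists_memLp_two_forall_mFourierCoeff_eq_of_summable h) x)
  else 0

/-- The complex synthesis behind the projection: an `L²` field `G` with `𝓕G = 𝟙_S ŵ` and
`P_S w = Re G`. [cite: Grafakos2014, Prop. 3.2.7 (4)] -/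
theorem exists_fourierSetProj_eq (S : Set (d → ℤ)) {w : UnitAddTorus d → EuclideanSpace ℝ d} (hw : MemLp w 2 volume) :
    ∃ G : UnitAddTorus d → EuclideanSpace ℂ d, MemLp G 2 volume ∧ (∀ k, mFourierCoeff G k = sectorCoeff S w k) ∧
      fourierSetProj S w = fun x => FunctionSpaces.EuclideanSpace.realPart (G x) := by
  have h := summable_sq_norm_sectorCoeff S hw
  refine ⟨Classical.choose (FunctionSpaces.Torus.exists_memLp_two_forall_mFourierCoeff_eq_of_summable h),
    (Classical.choose_spec (FunctionSpaces.Torus.exists_memLp_two_forall_mFourierCoeff_eq_of_summable h)).1,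
    (Classical.choose_spec (FunctionSpaces.Torus.exists_memLp_two_forall_mFourierCoeff_eq_of_summable h)).2, ?_⟩
  rw [fourierSetProj, dif_pos h]

/-- `P_S w ∈ L²`. [cite: Grafakos2014, Prop. 3.2.7 (4)] -/
theorem memLp_two_fourierSetProj (S : Set (d → ℤ)) {w : UnitAddTorus d → EuclideanSpace ℝ d} (hw : MemLp w 2 volume) :
    MemLp (fourierSetProj S w) 2 volume := by
  obtain ⟨G, hG, -, hP⟩ := exists_fourierSetProj_eq S hw
  rw [hP]
  exact ContinuousLinearMap.comp_memLp' FunctionSpaces.EuclideanSpace.realPart hG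

/-- `P_S w` is integrable. [cite: Grafakos2014, Prop. 3.2.7 (4)] -/
theorem integrable_fourierSetProj (S : Set (d → ℤ)) {w : UnitAddTorus d → EuclideanSpace ℝ d} (hw : MemLp w 2 volume) :
    Integrable (fourierSetProj S w) volume :=
  (memLp_two_fourierSetProj S hw).integrable one_le_two

/-- **The Fourier coefficients of the projection**: for a symmetric `S` and `w ∈ L²`,
`𝓕(complexify ∘ P_S w)(k) = 𝟙_S(k) ŵ(k)`. [cite: Grafakos2014, Prop. 3.2.7 (4)] -/
theorem mFourierCoeff_fourierSetProj {S : Set (d → ℤ)} (hS : ∀ k ∈ S, -k ∈ S)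
    {w : UnitAddTorus d → EuclideanSpace ℝ d} (hw : MemLp w 2 volume) (k : d → ℤ) :
    mFourierCoeff (FunctionSpaces.EuclideanSpace.complexify ∘ fourierSetProj S w) k = sectorCoeff S w k := by
  obtain ⟨G, hG, hGc, hP⟩ := exists_fourierSetProj_eq S hw
  rw [hP]
  exact FunctionSpaces.Torus.mFourierCoeff_complexify_realPart_comp_of_isConjSymm (hG.integrable one_le_two)
    (isConjSymm_sectorCoeff hS (hw.integrable one_le_two)) hGc k

/-- The projection preserves weak incompressibility. [cite: Grafakos2014, Prop. 3.2.7 (4)] -/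
theorem isWeaklyDivFree_fourierSetProj [DecidableEq d] {S : Set (d → ℤ)} (hS : ∀ k ∈ S, -k ∈ S)
    {w : UnitAddTorus d → EuclideanSpace ℝ d} (hw : MemLp w 2 volume)
    (hdiv : FunctionSpaces.Torus.IsWeaklyDivFree w) :
    FunctionSpaces.Torus.IsWeaklyDivFree (fourierSetProj S w) := by
  refine isWeaklyDivFree_of_sum_mul_mFourierCoeff_eq_zero (memLp_two_fourierSetProj S hw) fun k => ?_
  rw [mFourierCoeff_fourierSetProj hS hw k]
  by_cases hk : k ∈ S
  · rw [sectorCoeff_of_mem hk]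
    exact hdiv.sum_mul_mFourierCoeff_eq_zero hw k
  · simp [sectorCoeff_of_not_mem hk]

/-- The projection preserves zero mean. [cite: Grafakos2014, Prop. 3.2.7 (4)] -/
theorem hasZeroMean_fourierSetProj {S : Set (d → ℤ)} (hS : ∀ k ∈ S, -k ∈ S)
    {w : UnitAddTorus d → EuclideanSpace ℝ d} (hw : MemLp w 2 volume)
    (hmean : FunctionSpaces.Torus.HasZeroMean w) :
    FunctionSpaces.Torus.HasZeroMean (fourierSetProj S w) := by
  refine FunctionSpaces.Torus.hasZeroMean_of_mFourierCoeff_zero ?_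
  rw [mFourierCoeff_fourierSetProj hS hw 0]
  by_cases hk : (0 : d → ℤ) ∈ S
  · rw [sectorCoeff_of_mem hk]
    exact FunctionSpaces.Torus.mFourierCoeff_complexify_zero_of_hasZeroMean (hw.integrable one_le_two) hmean
  · exact sectorCoeff_of_not_mem hk

/-- The projection of a field whose frequencies avoid `0 ∈ S`... more simply: if `0 ∉ S` then `P_S w`
has zero mean. [cite: Grafakos2014, Prop. 3.2.7 (4)] -/
theorem hasZeroMean_fourierSetProj_of_zero_not_mem {S : Set (d → ℤ)} (hS : ∀ k ∈ S, -k ∈ S) (h0 : (0 : d → ℤ) ∉ S)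
    {w : UnitAddTorus d → EuclideanSpace ℝ d} (hw : MemLp w 2 volume) :
    FunctionSpaces.Torus.HasZeroMean (fourierSetProj S w) := by
  refine FunctionSpaces.Torus.hasZeroMean_of_mFourierCoeff_zero ?_
  rw [mFourierCoeff_fourierSetProj hS hw 0, sectorCoeff_of_not_mem h0]

/-- **The projection does not increase Sobolev norms**: `‖P_S w‖_{H^s} ≤ ‖w‖_{H^s}`.
[cite: Grafakos2014, Prop. 3.2.7 (4)] -/
theorem eSobolevNorm_fourierSetProj_le {S : Set (d → ℤ)} (hS : ∀ k ∈ S, -k ∈ S)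
    {w : UnitAddTorus d → EuclideanSpace ℝ d} (hw : MemLp w 2 volume) (s : ℝ) :
    FunctionSpaces.Torus.eSobolevNorm s (FunctionSpaces.EuclideanSpace.complexify ∘ fourierSetProj S w) ≤
      FunctionSpaces.Torus.eSobolevNorm s (FunctionSpaces.EuclideanSpace.complexify ∘ w) := by
  unfold FunctionSpaces.Torus.eSobolevNorm
  refine ENNReal.rpow_le_rpow (ENNReal.tsum_le_tsum fun k => ?_) (by norm_num)
  rw [mFourierCoeff_fourierSetProj hS hw k]
  gcongr
  rw [← ofReal_norm, ← ofReal_norm]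
  exact ENNReal.ofReal_le_ofReal (norm_sectorCoeff_le S w k)

/-- The projection preserves every Sobolev class `H^s`. [cite: Grafakos2014, Prop. 3.2.7 (4)] -/
theorem memSobolev_fourierSetProj {S : Set (d → ℤ)} (hS : ∀ k ∈ S, -k ∈ S)
    {w : UnitAddTorus d → EuclideanSpace ℝ d} (hw : MemLp w 2 volume) {s : ℝ}
    (hws : FunctionSpaces.Torus.MemSobolev s (FunctionSpaces.EuclideanSpace.complexify ∘ w)) :
    FunctionSpaces.Torus.MemSobolev s (FunctionSpaces.EuclideanSpace.complexify ∘ fourierSetProj S w) :=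
  ⟨FunctionSpaces.Torus.integrable_complexify_comp (integrable_fourierSetProj S hw),
    (eSobolevNorm_fourierSetProj_le hS hw s).trans_lt hws.2⟩

/-- **Parseval for the projection**: `∫ ‖P_S w‖² = ∑' ‖𝟙_S(k) ŵ(k)‖²`. [cite: Grafakos2014, Prop. 3.2.7 (3)] -/
theorem integral_norm_sq_fourierSetProj {S : Set (d → ℤ)} (hS : ∀ k ∈ S, -k ∈ S)
    {w : UnitAddTorus d → EuclideanSpace ℝ d} (hw : MemLp w 2 volume) :
    ∫ x, ‖fourierSetProj S w x‖ ^ 2 = ∑' k, ‖sectorCoeff S w k‖ ^ 2 := by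
  rw [FunctionSpaces.Torus.integral_norm_sq_eq_tsum (memLp_two_fourierSetProj S hw)]
  exact tsum_congr fun k => by rw [mFourierCoeff_fourierSetProj hS hw k]

/-- `∫ ‖P_S w‖² ≤ ∫ ‖w‖²`. [cite: Grafakos2014, Prop. 3.2.7 (3)] -/
theorem integral_norm_sq_fourierSetProj_le {S : Set (d → ℤ)} (hS : ∀ k ∈ S, -k ∈ S)
    {w : UnitAddTorus d → EuclideanSpace ℝ d} (hw : MemLp w 2 volume) :
    ∫ x, ‖fourierSetProj S w x‖ ^ 2 ≤ ∫ x, ‖w x‖ ^ 2 := by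
  rw [integral_norm_sq_fourierSetProj hS hw, FunctionSpaces.Torus.integral_norm_sq_eq_tsum hw]
  exact Summable.tsum_le_tsum (fun k => pow_le_pow_left₀ (norm_nonneg _) (norm_sectorCoeff_le S w k) 2)
    (summable_sq_norm_sectorCoeff S hw) (FunctionSpaces.Torus.hasSum_sq_norm_mFourierCoeff_complexify hw).summable

/-! ## Additivity -/

/-- Real fields with the same Fourier coefficients agree a.e. [cite: Grafakos2014, Prop. 3.2.7 (4)] -/
theorem ae_eq_of_forall_mFourierCoeff_complexify_eq {u v : UnitAddTorus d → EuclideanSpace ℝ d}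
    (hu : Integrable u volume) (hv : Integrable v volume)
    (h : ∀ k, mFourierCoeff (FunctionSpaces.EuclideanSpace.complexify ∘ u) k =
      mFourierCoeff (FunctionSpaces.EuclideanSpace.complexify ∘ v) k) :
    u =ᵐ[volume] v := by
  have hae := FunctionSpaces.Torus.ae_eq_of_forall_mFourierCoeff_eq
    (FunctionSpaces.Torus.integrable_complexify_comp hu) (FunctionSpaces.Torus.integrable_complexify_comp hv) h
  filter_upwards [hae] with x hx
  exact FunctionSpaces.EuclideanSpace.complexify_injective hx

/-- **Additivity on disjoint symmetric sets**: `P_{S₁ ∪ S₂} w = P_{S₁} w + P_{S₂} w` a.e.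
[cite: Grafakos2014, Prop. 3.2.7 (4)] -/
theorem fourierSetProj_union_ae_eq {S₁ S₂ : Set (d → ℤ)} (hS₁ : ∀ k ∈ S₁, -k ∈ S₁) (hS₂ : ∀ k ∈ S₂, -k ∈ S₂)
    (hdisj : Disjoint S₁ S₂) {w : UnitAddTorus d → EuclideanSpace ℝ d} (hw : MemLp w 2 volume) :
    fourierSetProj (S₁ ∪ S₂) w =ᵐ[volume] fun x => fourierSetProj S₁ w x + fourierSetProj S₂ w x := by
  have hS : ∀ k ∈ S₁ ∪ S₂, -k ∈ S₁ ∪ S₂ := fun k hk =>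
    hk.elim (fun h => Or.inl (hS₁ k h)) (fun h => Or.inr (hS₂ k h))
  have hi₁ := integrable_fourierSetProj S₁ hw
  have hi₂ := integrable_fourierSetProj S₂ hw
  refine ae_eq_of_forall_mFourierCoeff_complexify_eq (integrable_fourierSetProj _ hw) (hi₁.add hi₂) fun k => ?_
  have e : (FunctionSpaces.EuclideanSpace.complexify ∘ fun x => fourierSetProj S₁ w x + fourierSetProj S₂ w x) =
      (FunctionSpaces.EuclideanSpace.complexify ∘ fourierSetProj S₁ w) +
        (FunctionSpaces.EuclideanSpace.complexify ∘ fourierSetProj S₂ w) := by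
    funext x
    simp only [Function.comp_apply, Pi.add_apply, map_add]
  rw [e, FunctionSpaces.Torus.mFourierCoeff_add (FunctionSpaces.Torus.integrable_complexify_comp hi₁)
    (FunctionSpaces.Torus.integrable_complexify_comp hi₂), mFourierCoeff_fourierSetProj hS hw,
    mFourierCoeff_fourierSetProj hS₁ hw, mFourierCoeff_fourierSetProj hS₂ hw, sectorCoeff, sectorCoeff, sectorCoeff,
    indicator_union_of_disjoint hdisj]

/-- The projection onto all frequencies is the field itself, a.e. [cite: Grafakos2014, Prop. 3.2.7 (4)] -/
theorem fourierSetProj_univ_ae_eq {w : UnitAddTorus d → EuclideanSpace ℝ d} (hw : MemLp w 2 volume) :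
    fourierSetProj univ w =ᵐ[volume] w := by
  refine ae_eq_of_forall_mFourierCoeff_complexify_eq (integrable_fourierSetProj _ hw) (hw.integrable one_le_two)
    fun k => ?_
  rw [mFourierCoeff_fourierSetProj (fun k _ => mem_univ _) hw k, sectorCoeff, indicator_univ]

/-- Complementary projections recompose the field, a.e.: `P_S w + P_{Sᶜ} w = w`.
[cite: Grafakos2014, Prop. 3.2.7 (4)] -/
theorem fourierSetProj_add_compl_ae_eq {S : Set (d → ℤ)} (hS : ∀ k ∈ S, -k ∈ S)
    {w : UnitAddTorus d → EuclideanSpace ℝ d} (hw : MemLp w 2 volume) :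
    (fun x => fourierSetProj S w x + fourierSetProj Sᶜ w x) =ᵐ[volume] w := by
  have hSc : ∀ k ∈ Sᶜ, -k ∈ Sᶜ := fun k hk h => hk (by simpa using hS (-k) h)
  have h1 := fourierSetProj_union_ae_eq hS hSc disjoint_compl_right hw
  rw [union_compl_self] at h1
  exact h1.symm.trans (fourierSetProj_univ_ae_eq hw)

/-- **Finite disjoint families of symmetric sets**: `P_{⋃ᵢ Sᵢ} w = ∑ᵢ P_{Sᵢ} w` a.e. (the Bloch-sector
splitting of an `L²` datum). [cite: Grafakos2014, Prop. 3.2.7 (4)] -/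
theorem fourierSetProj_biUnion_ae_eq {ι : Type*} (s : Finset ι) (S : ι → Set (d → ℤ))
    (hS : ∀ i ∈ s, ∀ k ∈ S i, -k ∈ S i) (hdisj : (s : Set ι).PairwiseDisjoint S)
    {w : UnitAddTorus d → EuclideanSpace ℝ d} (hw : MemLp w 2 volume) :
    fourierSetProj (⋃ i ∈ s, S i) w =ᵐ[volume] fun x => ∑ i ∈ s, fourierSetProj (S i) w x := by
  classical
  induction s using Finset.induction_on with
  | empty =>
      have e0 : (⋃ i ∈ (∅ : Finset ι), S i) = (∅ : Set (d → ℤ)) := by simp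
      rw [e0]
      simp only [Finset.sum_empty]
      refine ae_eq_of_forall_mFourierCoeff_complexify_eq (integrable_fourierSetProj _ hw) (integrable_zero _ _ _)
        fun k => ?_
      rw [mFourierCoeff_fourierSetProj (fun k hk => hk.elim) hw k, sectorCoeff, indicator_empty,
        FunctionSpaces.Torus.mFourierCoeff_eq_integral_volume]
      simp
  | insert a s ha ih =>
      have hS' : ∀ i ∈ s, ∀ k ∈ S i, -k ∈ S i := fun i hi => hS i (Finset.mem_insert_of_mem hi)
      have hdisj' : (s : Set ι).PairwiseDisjoint S :=
        hdisj.subset (Finset.coe_subset.2 (Finset.subset_insert a s))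
      have hSa : ∀ k ∈ S a, -k ∈ S a := hS a (Finset.mem_insert_self a s)
      have hU : ∀ k ∈ ⋃ i ∈ s, S i, -k ∈ ⋃ i ∈ s, S i := by
        intro k hk
        simp only [mem_iUnion] at hk ⊢
        obtain ⟨i, hi, hki⟩ := hk
        exact ⟨i, hi, hS' i hi k hki⟩
      have hd : Disjoint (S a) (⋃ i ∈ s, S i) := by
        rw [disjoint_iUnion₂_right]
        intro i hi
        exact hdisj (Finset.mem_coe.2 (Finset.mem_insert_self a s))
          (Finset.mem_coe.2 (Finset.mem_insert_of_mem hi)) (fun h => ha (h ▸ hi))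
      rw [Finset.set_biUnion_insert]
      filter_upwards [fourierSetProj_union_ae_eq hSa hU hd hw, ih hS' hdisj'] with x hx hih
      rw [hx, Finset.sum_insert ha, hih]

/-! ## Bloch sectors `±ℓ + nℤ^d`

The symmetric frequency sets of the Floquet–Bloch decomposition relative to the sublattice `nℤ^d`:
`blochSector n ℓ = (ℓ + nℤ^d) ∪ (-ℓ + nℤ^d)`. They are symmetric under `k ↦ -k`, and finitely many of
them, pairwise disjoint, cover `ℤ^d` (one per unordered pair `{c, -c}` of residue classes
`c ∈ (ℤ/n)^d`). -/

/-- The Bloch sector of `ℓ` modulo `n`: `(ℓ + nℤ^d) ∪ (-ℓ + nℤ^d)` (the frequencies of the characters of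
`T^d` in the classes `±ℓ` of `ℤ^d / nℤ^d`; Bloch/Floquet decomposition relative to the sublattice `nℤ^d`).
[cite: Grafakos2014, §3.1] -/
def blochSector (n : ℕ) (ℓ : d → ℤ) : Set (d → ℤ) :=
  {k | (∃ z : d → ℤ, k = ℓ + (n : ℤ) • z) ∨ (∃ z : d → ℤ, k = -ℓ + (n : ℤ) • z)}

omit [Fintype d] in
/-- Membership in a Bloch sector, unfolded. [cite: Grafakos2014, §3.1] -/
theorem mem_blochSector_iff {n : ℕ} {ℓ k : d → ℤ} :
    k ∈ blochSector n ℓ ↔ (∃ z : d → ℤ, k = ℓ + (n : ℤ) • z) ∨ (∃ z : d → ℤ, k = -ℓ + (n : ℤ) • z) :=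
  Iff.rfl

omit [Fintype d] in
/-- Bloch sectors are symmetric: `k ∈ blochSector n ℓ → -k ∈ blochSector n ℓ`. [cite: Grafakos2014, §3.1] -/
theorem neg_mem_blochSector {n : ℕ} {ℓ k : d → ℤ} (hk : k ∈ blochSector n ℓ) : -k ∈ blochSector n ℓ := by
  rcases hk with ⟨z, rfl⟩ | ⟨z, rfl⟩
  · exact Or.inr ⟨-z, by rw [neg_add, smul_neg]⟩
  · exact Or.inl ⟨-z, by rw [neg_add, neg_neg, smul_neg]⟩

omit [Fintype d] in
/-- `ℓ ∈ blochSector n ℓ`. [cite: Grafakos2014, §3.1] -/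
theorem self_mem_blochSector (n : ℕ) (ℓ : d → ℤ) : ℓ ∈ blochSector n ℓ :=
  Or.inl ⟨0, by rw [smul_zero, add_zero]⟩

omit [Fintype d] in
/-- The coset condition through residues: `k ∈ ℓ + nℤ^d ↔ k ≡ ℓ (mod n)` componentwise.
[cite: Grafakos2014, §3.1] -/
theorem exists_eq_add_smul_iff {n : ℕ} {ℓ k : d → ℤ} :
    (∃ z : d → ℤ, k = ℓ + (n : ℤ) • z) ↔ ∀ i, ((k i : ℤ) : ZMod n) = ((ℓ i : ℤ) : ZMod n) := by
  constructor
  · rintro ⟨z, rfl⟩ i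
    simp [Pi.add_apply]
  · intro h
    refine ⟨fun i => (k i - ℓ i) / (n : ℤ), funext fun i => ?_⟩
    have hdvd : (n : ℤ) ∣ k i - ℓ i := (ZMod.intCast_eq_intCast_iff_dvd_sub (ℓ i) (k i) n).1 (h i).symm
    simp only [Pi.add_apply, Pi.smul_apply, smul_eq_mul]
    rw [Int.mul_ediv_cancel' hdvd]
    ring

omit [Fintype d] in
/-- Membership in a Bloch sector through residues: `k ∈ blochSector n ℓ ↔ (k̄ = ℓ̄ ∨ k̄ = -ℓ̄)` in
`(ℤ/n)^d`. [cite: Grafakos2014, §3.1] -/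
theorem mem_blochSector_iff_residue {n : ℕ} {ℓ k : d → ℤ} :
    k ∈ blochSector n ℓ ↔
      (fun i => ((k i : ℤ) : ZMod n)) = (fun i => ((ℓ i : ℤ) : ZMod n)) ∨
        (fun i => ((k i : ℤ) : ZMod n)) = -(fun i => ((ℓ i : ℤ) : ZMod n)) := by
  rw [mem_blochSector_iff, exists_eq_add_smul_iff, exists_eq_add_smul_iff]
  simp only [funext_iff, Pi.neg_apply, Int.cast_neg]

/-- **A finite pairwise-disjoint covering of `ℤ^d` by Bloch sectors** (`n ≥ 1`): one sector per
unordered pair `{c, -c}` of residue classes in `(ℤ/n)^d`. [cite: Grafakos2014, §3.1] -/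
theorem exists_finset_blochSector_partition [DecidableEq d] {n : ℕ} (hn : 0 < n) :
    ∃ ι : Finset (d → ℤ), (ι : Set (d → ℤ)).PairwiseDisjoint (blochSector n) ∧
      (⋃ ℓ ∈ ι, blochSector n ℓ) = univ := by
  classical
  haveI : NeZero n := ⟨hn.ne'⟩
  -- residues, an injective ranking of the residue classes, and the lift back to `ℤ^d`
  let ρ : (d → ℤ) → (d → ZMod n) := fun k i => ((k i : ℤ) : ZMod n)
  let f : (d → ZMod n) → ℕ := fun c => (Fintype.equivFin (d → ZMod n) c : ℕ)
  have hf : Function.Injective f := fun c c' h =>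
    (Fintype.equivFin (d → ZMod n)).injective (Fin.ext h)
  let lift : (d → ZMod n) → (d → ℤ) := fun c i => ((c i).val : ℤ)
  have hρlift : ∀ c, ρ (lift c) = c := fun c => funext fun i => by
    simp [ρ, lift]
  have hmem : ∀ c k, k ∈ blochSector n (lift c) ↔ ρ k = c ∨ ρ k = -c := fun c k => by
    rw [mem_blochSector_iff_residue]
    change ρ k = ρ (lift c) ∨ ρ k = -ρ (lift c) ↔ _
    rw [hρlift]
  -- representatives: the classes ranked no higher than their negatives
  let R : Finset (d → ZMod n) := Finset.univ.filter fun c => f c ≤ f (-c)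
  refine ⟨R.image lift, ?_, ?_⟩
  · intro ℓ hℓ ℓ' hℓ' hne
    simp only [Finset.coe_image, mem_image, Finset.mem_coe, R, Finset.mem_filter, Finset.mem_univ,
      true_and] at hℓ hℓ'
    obtain ⟨c, hc, rfl⟩ := hℓ
    obtain ⟨c', hc', rfl⟩ := hℓ'
    have hcc' : c ≠ c' := fun h => hne (h ▸ rfl)
    rw [Function.onFun, disjoint_left]
    intro k hk hk'
    rw [hmem] at hk hk'
    have hneg : c' = -c := by
      rcases hk with h | h <;> rcases hk' with h' | h'
      · exact (hcc' (h.symm.trans h')).elim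
      · rw [h.symm.trans h', neg_neg]
      · exact h'.symm.trans h
      · exact (hcc' (neg_injective (h.symm.trans h'))).elim
    subst hneg
    have h1 : f c ≤ f (-c) := hc
    have h2 : f (-c) ≤ f c := by simpa using hc'
    exact hcc' (hf (le_antisymm h1 h2)) |>.elim
  · refine eq_univ_of_forall fun k => ?_
    simp only [mem_iUnion, Finset.mem_image, R, Finset.mem_filter, Finset.mem_univ, true_and,
      exists_prop]
    by_cases h : f (ρ k) ≤ f (-ρ k)
    · exact ⟨lift (ρ k), ⟨ρ k, h, rfl⟩, (hmem _ _).2 (Or.inl rfl)⟩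
    · refine ⟨lift (-ρ k), ⟨-ρ k, ?_, rfl⟩, (hmem _ _).2 (Or.inr (neg_neg (ρ k)).symm)⟩
      rw [neg_neg]
      exact (not_le.1 h).le

/-! ## The Bloch-sector splitting of an `L²` datum -/

/-- **Bloch-sector pieces of a real `L²` vector field.** For `n ≥ 1` and `w ∈ L²(T^d; ℝ^d)` there are
finitely many pairwise disjoint Bloch sectors and fields `v ℓ ∈ L²`, `v ℓ` Fourier-supported in
`blochSector n ℓ`, with `w = ∑_ℓ v ℓ` POINTWISE; every Sobolev class `H^s`, weak incompressibility and
zero mean pass from `w` to each piece. (Pieces: `v ℓ = P_{blochSector n ℓ} w`, the a.e.-null remainder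
`w - ∑_ℓ P_ℓ w` being added to one of them.) [cite: Grafakos2014, Prop. 3.2.7 (4)] -/
theorem exists_blochSector_pieces [DecidableEq d] {n : ℕ} (hn : 0 < n)
    {w : UnitAddTorus d → EuclideanSpace ℝ d} (hw : MemLp w 2 volume) :
    ∃ ι : Finset (d → ℤ), ∃ v : (d → ℤ) → UnitAddTorus d → EuclideanSpace ℝ d,
      (ι : Set (d → ℤ)).PairwiseDisjoint (blochSector n) ∧
      (∀ ℓ ∈ ι, MemLp (v ℓ) 2 volume ∧
        (∀ k, k ∉ blochSector n ℓ → mFourierCoeff (FunctionSpaces.EuclideanSpace.complexify ∘ v ℓ) k = 0) ∧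
        (∀ s : ℝ, FunctionSpaces.Torus.MemSobolev s (FunctionSpaces.EuclideanSpace.complexify ∘ w) →
          FunctionSpaces.Torus.MemSobolev s (FunctionSpaces.EuclideanSpace.complexify ∘ v ℓ)) ∧
        (FunctionSpaces.Torus.IsWeaklyDivFree w → FunctionSpaces.Torus.IsWeaklyDivFree (v ℓ)) ∧
        (FunctionSpaces.Torus.HasZeroMean w → FunctionSpaces.Torus.HasZeroMean (v ℓ))) ∧
      w = fun x => ∑ ℓ ∈ ι, v ℓ x := by
  classical
  obtain ⟨ι, hdisj, hcover⟩ := exists_finset_blochSector_partition (d := d) hn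
  have hsymm : ∀ ℓ ∈ ι, ∀ k ∈ blochSector n ℓ, -k ∈ blochSector n ℓ := fun ℓ _ k hk => neg_mem_blochSector hk
  -- `ι` is nonempty: `0` lies in some sector
  have hne : ι.Nonempty := by
    have h0 : (0 : d → ℤ) ∈ ⋃ ℓ ∈ ι, blochSector n ℓ := by rw [hcover]; exact mem_univ _
    simp only [mem_iUnion] at h0
    obtain ⟨ℓ, hℓ, -⟩ := h0
    exact ⟨ℓ, hℓ⟩
  obtain ⟨ℓ₀, hℓ₀⟩ := hne
  -- the a.e.-null remainder
  set P : (d → ℤ) → UnitAddTorus d → EuclideanSpace ℝ d := fun ℓ => fourierSetProj (blochSector n ℓ) w with hP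
  set r : UnitAddTorus d → EuclideanSpace ℝ d := fun x => w x - ∑ ℓ ∈ ι, P ℓ x with hr
  have hr0 : r =ᵐ[volume] 0 := by
    have h1 := fourierSetProj_biUnion_ae_eq ι (blochSector n) hsymm hdisj hw
    rw [hcover] at h1
    filter_upwards [h1, fourierSetProj_univ_ae_eq hw] with x hx hxu
    simp only [hr, Pi.zero_apply, hP]
    rw [← hx, hxu, sub_self]
  refine ⟨ι, fun ℓ x => P ℓ x + (if ℓ = ℓ₀ then r x else 0), hdisj, fun ℓ hℓ => ?_, ?_⟩
  · -- the piece `v ℓ` agrees a.e. with `P ℓ`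
    have hae : (fun x => P ℓ x + (if ℓ = ℓ₀ then r x else 0)) =ᵐ[volume] P ℓ := by
      filter_upwards [hr0] with x hx
      rw [hx, Pi.zero_apply, ite_self, add_zero]
    have haeC : (FunctionSpaces.EuclideanSpace.complexify ∘ fun x => P ℓ x + (if ℓ = ℓ₀ then r x else 0)) =ᵐ[volume]
        (FunctionSpaces.EuclideanSpace.complexify ∘ P ℓ) := by
      filter_upwards [hae] with x hx
      simp only [Function.comp_apply, hx]
    have hPℓ : MemLp (P ℓ) 2 volume := memLp_two_fourierSetProj _ hw
    refine ⟨hPℓ.ae_eq hae.symm, fun k hk => ?_, fun s hs => ?_, fun hdiv => ?_, fun hmean => ?_⟩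
    · rw [FunctionSpaces.Torus.mFourierCoeff_congr_ae haeC k, hP,
        mFourierCoeff_fourierSetProj (hsymm ℓ hℓ) hw k, sectorCoeff_of_not_mem hk]
    · exact (FunctionSpaces.Torus.memSobolev_congr_of_ae_eq haeC).2
        (memSobolev_fourierSetProj (hsymm ℓ hℓ) hw hs)
    · exact (isWeaklyDivFree_fourierSetProj (hsymm ℓ hℓ) hw hdiv).congr_ae hae.symm
    · change ∫ x, (P ℓ x + (if ℓ = ℓ₀ then r x else 0)) = 0
      rw [integral_congr_ae hae]
      exact hasZeroMean_fourierSetProj (hsymm ℓ hℓ) hw hmean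
  · funext x
    rw [Finset.sum_add_distrib, Finset.sum_ite_eq' ι ℓ₀ (fun _ => r x), if_pos hℓ₀, hr]
    simp only
    abel

end Torus

end Literature.Analysis.FluidPDE

end
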